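import Summits.QuantumFields.BalabanUV.T4Continuum.Support.NE3EndpointPackageOfDecomposedRep
import HarnessLib

/-!
# T⁴ programme, node NE3 — route Π, file 5b: THE LETTERS OF `DecomposedRep` AND OF `EndpointChart` ARE MONOTONE — the uniform-letter device
# for the END over `sfClass` (per-pair letters are dominated by uniform ones)

NE3 (node U1b), row NE3 OWNER `b2b-balaban-t4-ne3-p1` (gen 26); announced in the owner's ONLINE line (journal l.24333) as the device g25's HANDOFF asked for
(«prove a `DecomposedRep` monotonicity lemma in ν, κ₁, κ₂, or bound the per-pair letters by uniform ones»).  Inputs BY NAME: `NE3ProductPathChart.DecomposedRep`,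
`NE3EndpointChart.EndpointChart`, `NE3EnergyWeightedShapes.energyNormW_nonneg`, file 5 `NE3EndpointPackageOfDecomposedRep.hchartPackage_of_decomposedRep`.

WHY.  The END `NE3EnergyRateWSupLines.ne3EnergyRateWSup_sfClass_of_lines` asks for ONE quadruple `(θ, κ, θ₀, q)` serving every level `j`, every datum `V` and
every minimiser pair; route Π's junction `NE3DecomposedRepOfShapes.decomposedRep_of_shapes` produces per-pair sizes `(ν, κ₁, κ₂)` that are explicit polynomials
in per-pair currencies (`α₀·L^{j+1}`, the majorant constant `C`, window radii, …).  Since the three SIZES of `DecomposedRep` and the four LETTERS of `EndpointChart`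
multiply a NON-NEGATIVE norm of the reference direction, both shapes are monotone in their letters, so per-pair letters bounded by uniform ones give the
uniform package.

CONTENT ([folklore]; 0 sorry; no data): §1 `decomposedRep_mono` (in `ν, κ₁, κ₂`; the radius `a` is NOT monotone — it multiplies the left sides of `curlN`∕`l1N`);
§2 `endpointChart_mono` (in `θ, κ, θ₀, q` at a reference direction of non-negative norm); §3 **`hchartPackage_of_decomposedRep_le`** — file 5's ∃-package
with DOMINATING letters `ν ≤ ν̄`, `κ₁ ≤ κ̄₁`, `κ₂ ≤ κ̄₂`: `θ = 2(1+4√(16d+1))ν̄`, `κ = 2κ̄₁ + 912dκ̄₂`, `θ₀ = ν̄ + 23√2√(16d+1)(1+ν̄)`, `q = 0`.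

HONEST FRAMING.  Bookkeeping only; `DecomposedRep` and the level lines are HYPOTHESES; (P♮)_W's numeric lines, (H∃), T-E_w♯ and NE3 are NOT proved; spine
PROVED 0∕9; finite T⁴ rung (B)+1 — NOT infinite volume, NOT mass gap, NOT `BetaPertH`, NOT Clay.  PLACEMENT: `Summits/QuantumFields/BalabanUV/`.
HONEST DEPENDENCY: continuum YM on T⁴ ⇐ BetaPertH ∧ nine spine estimates (0/9 proved); BetaPertH ⇐ (D1) ∧ (D4) ∧ CAP+tail; G-an2-4 gates asym, D1 and NE2/3/4.
-/

set_option autoImplicit false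

open scoped BigOperators Matrix.Norms.L2Operator
open NormedSpace Finset

namespace Summit.QuantumFields.BalabanUV.T4Continuum.NE3ChartLettersMono

open Set
open Literature.MathematicalPhysics.QuantumFieldTheory.Balaban1983to89
open B7Prop1Explicit B7Prop2Explicit
open T4AveragingDeficitWall (IsUnitaryCfg curl)
open T4AveragingDeficitWallBoundary (periodBox)
open AveragingDeficitChartCalculus (cavg)
open MinimalActionLevels (perWin)
open NE3EnergyWeightedShapes (energyNormW energyNormW_nonneg)
open NE3FrameFreeSliceW (frameFreeBlockLandauW)
open NE3EndpointChart (EndpointChart)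
open NE3ProductPathChart (DecomposedRep)
open NE3EndpointPackageOfDecomposedRep (hchartPackage_of_decomposedRep)

noncomputable section

variable {d : ℕ} {n : Type*} [Fintype n] [DecidableEq n]

/-! ## §1 `DecomposedRep` is monotone in its three sizes -/

/-- **`DecomposedRep` IS MONOTONE IN `(ν, κ₁, κ₂)`**: the three SIZES bound non-negative quantities by the letter times a non-negative power of the weighted
norm of the tangent datum, so larger letters are implied.  (The radius `a` is not a monotone letter.) [folklore] -/
theorem decomposedRep_mono {𝒞 : ℕ → _root_.Set (Site d → Fin d → (Matrix n n ℂ)ˣ)} {L N k : ℕ}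
    {V UA UB : Site d → Fin d → (Matrix n n ℂ)ˣ} {u : Site d → (Matrix n n ℂ)ˣ} {X Nn : Site d → Fin d → Matrix n n ℂ}
    {α αN ν κ₁ κ₂ a ν' κ₁' κ₂' : ℝ} (h : DecomposedRep 𝒞 L N k V UA UB u X Nn α αN ν κ₁ κ₂ a)
    (hν : ν ≤ ν') (hκ₁ : κ₁ ≤ κ₁') (hκ₂ : κ₂ ≤ κ₂') :
    DecomposedRep 𝒞 L N k V UA UB u X Nn α αN ν' κ₁' κ₂' a := by
  have hE : 0 ≤ energyNormW L k (cavg L UB) X (periodBox (d := d) (N * L ^ k)) := energyNormW_nonneg _ _ _ _ _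
  have hE2 : 0 ≤ energyNormW L k (cavg L UB) X (periodBox (d := d) (N * L ^ k)) ^ 2 := sq_nonneg _
  exact
    { gauge := h.gauge
      rep := h.rep
      skewX := h.skewX
      perX := h.perX
      skewN := h.skewN
      perN := h.perN
      tangent := h.tangent
      supX := h.supX
      supN := h.supN
      hα0 := h.hα0
      hαN0 := h.hαN0
      hα := h.hα
      hαN := h.hαN
      hαk := h.hαk
      admW := h.admW
      ha := h.ha
      small := h.small
      nwN := h.nwN.trans (mul_le_mul_of_nonneg_right hν hE)
      curlN := h.curlN.trans (mul_le_mul_of_nonneg_right hκ₁ hE2)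
      l1N := h.l1N.trans (mul_le_mul_of_nonneg_right hκ₂ hE2) }

/-! ## §2 `EndpointChart` is monotone in its four letters -/

/-- **`EndpointChart` IS MONOTONE IN `(θ, κ, θ₀, q)`** at a reference direction of non-negative norm. [folklore] -/
theorem endpointChart_mono {𝒞 : ℕ → _root_.Set (Site d → Fin d → (Matrix n n ℂ)ˣ)} {L N k : ℕ}
    {V UA UB : Site d → Fin d → (Matrix n n ℂ)ˣ} {u : Site d → (Matrix n n ℂ)ˣ}
    {Γ Ψ Ψ' : ℝ → Site d → Fin d → Matrix n n ℂ} {Xref : Site d → Fin d → Matrix n n ℂ} {T : _root_.Set (Site d → Fin d → Matrix n n ℂ)}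
    {Nrm : (Site d → Fin d → Matrix n n ℂ) → ℝ} {θ κ θ₀ q a θ' κ' θ₀' q' : ℝ}
    (h : EndpointChart 𝒞 L N k V UA UB u Γ Ψ Ψ' Xref T Nrm θ κ θ₀ q a) (hN : 0 ≤ Nrm Xref)
    (hθ : θ ≤ θ') (hκ : κ ≤ κ') (hθ₀ : θ₀ ≤ θ₀') (hq : q ≤ q') :
    EndpointChart 𝒞 L N k V UA UB u Γ Ψ Ψ' Xref T Nrm θ' κ' θ₀' q' a := by
  have hN2 : 0 ≤ Nrm Xref ^ 2 := sq_nonneg _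
  exact
    { gauge := h.gauge
      rep := h.rep
      endW := h.endW
      skew := h.skew
      per := h.per
      vel := h.vel
      acc := h.acc
      skewAcc := h.skewAcc
      admW := h.admW
      refT := h.refT
      perT := h.perT
      velocity := fun t ht => (h.velocity t ht).trans (mul_le_mul_of_nonneg_right hθ hN)
      close := h.close.trans (mul_le_mul_of_nonneg_right (by linarith) hN)
      resDev := h.resDev.trans (by nlinarith [mul_le_mul_of_nonneg_right hq hN2])
      small := h.small
      accel := fun t ht => (h.accel t ht).trans (mul_le_mul_of_nonneg_right hκ hN2) }

/-! ## §3 File 5's package with dominating letters -/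

/-- **THE ∃-PACKAGE OF `hchart` FROM A DECOMPOSED REPRESENTATIVE WITH DOMINATED SIZES.**  File 5's `hchartPackage_of_decomposedRep` after §1: if the pair's
sizes satisfy `ν ≤ ν̄`, `κ₁ ≤ κ̄₁`, `κ₂ ≤ κ̄₂`, the endpoint-chart package holds with the letters of `(ν̄, κ̄₁, κ̄₂)` — so ONE quadruple `(θ, κ, θ₀, q)` serves every
pair whose sizes are so dominated. [folklore] -/
theorem hchartPackage_of_decomposedRep_le [Nonempty n] {𝒞 : ℕ → _root_.Set (Site d → Fin d → (Matrix n n ℂ)ˣ)} {L N k : ℕ} (hL : 1 ≤ L)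
    (hN : 1 ≤ N) {V UA UB : Site d → Fin d → (Matrix n n ℂ)ˣ} (hW : IsUnitaryCfg (cavg L UB)) {u : Site d → (Matrix n n ℂ)ˣ}
    {X Nn : Site d → Fin d → Matrix n n ℂ} {α αN ν κ₁ κ₂ a CP Λ νb κ₁b κ₂b : ℝ} (h : DecomposedRep 𝒞 L N k V UA UB u X Nn α αN ν κ₁ κ₂ a)
    (hν : ν ≤ νb) (hκ₁ : κ₁ ≤ κ₁b) (hκ₂ : κ₂ ≤ κ₂b) (hα : α ≤ 1 / 40) (hαN : αN ≤ 1 / 100)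
    (hJ1 : (1 + 24 * Real.sqrt d * (Real.exp (10 * (α + αN)) - 1) * (L : ℝ) ^ k) ^ 2 + 48 * d * a * ((L : ℝ) ^ k) ^ 2 ≤ Λ)
    (hJ2 : 112 * (d : ℝ) * a * CP * ((L : ℝ) ^ k) ^ 2 ≤ 1 / (2 * (Fintype.card n : ℝ))) :
    ∃ (u' : Site d → (Matrix n n ℂ)ˣ) (Γ Ψ Ψ' : ℝ → Site d → Fin d → Matrix n n ℂ) (Xref : Site d → Fin d → Matrix n n ℂ) (α' a' : ℝ),
      0 ≤ α' ∧ 0 ≤ a' ∧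
      EndpointChart 𝒞 L N k V UA UB u' Γ Ψ Ψ' Xref (frameFreeBlockLandauW L N k (cavg L UB))
        (fun Y => energyNormW L k (cavg L UB) Y (periodBox (N * L ^ k)))
        (2 * (1 + 4 * Real.sqrt (16 * d + 1)) * νb) (2 * κ₁b + 912 * d * κ₂b) (νb + 23 * Real.sqrt 2 * Real.sqrt (16 * d + 1) * (1 + νb)) 0 a' ∧
      (∀ t (x : Site d) (μ : Fin d), ‖Γ t x μ‖ ≤ α') ∧
      (1 + 24 * Real.sqrt d * (Real.exp α' - 1) * (L : ℝ) ^ k) ^ 2 + 48 * d * a' * ((L : ℝ) ^ k) ^ 2 ≤ Λ ∧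
      112 * (d : ℝ) * a' * CP * ((L : ℝ) ^ k) ^ 2 ≤ 1 / (2 * (Fintype.card n : ℝ)) :=
  hchartPackage_of_decomposedRep hL hN hW (decomposedRep_mono h hν hκ₁ hκ₂) hα hαN hJ1 hJ2

/-- **UNIFORM LETTERS OVER A FAMILY** (the form the END consumes): if for every level `j`, datum `V ∈ dom` and minimiser-type pair the hypotheses `P j V U_A U_B`
yield a decomposed representative with sizes dominated by `(ν̄, κ̄₁, κ̄₂)`, sup data `α ≤ 1∕40`, `αN ≤ 1∕100` and the level lines (J1)(J2) against uniform
`(Λ, CP)`, then the END's `hchart` clause holds with the ONE quadruple `θ = 2(1+4√(16d+1))ν̄`, `κ = 2κ̄₁ + 912dκ̄₂`, `θ₀ = ν̄ + 23√2√(16d+1)(1+ν̄)`, `q = 0`.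
[folklore] -/
theorem hchart_uniform_of_decomposedRep [Nonempty n] {𝒞 : ℕ → _root_.Set (Site d → Fin d → (Matrix n n ℂ)ˣ)} {L N : ℕ} (hL : 1 ≤ L)
    (hN : 1 ≤ N) {dom : _root_.Set (Site d → Fin d → (Matrix n n ℂ)ˣ)}
    {P : ℕ → (Site d → Fin d → (Matrix n n ℂ)ˣ) → (Site d → Fin d → (Matrix n n ℂ)ˣ) → (Site d → Fin d → (Matrix n n ℂ)ˣ) → Prop}
    {CP Λ νb κ₁b κ₂b : ℝ}
    (hrep : ∀ j : ℕ, ∀ V ∈ dom, ∀ UA UB : Site d → Fin d → (Matrix n n ℂ)ˣ, P j V UA UB →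
      IsUnitaryCfg (cavg L UB) ∧
      ∃ (u : Site d → (Matrix n n ℂ)ˣ) (X Nn : Site d → Fin d → Matrix n n ℂ) (α αN ν κ₁ κ₂ a : ℝ),
        DecomposedRep 𝒞 L N (j + 1) V UA UB u X Nn α αN ν κ₁ κ₂ a ∧ ν ≤ νb ∧ κ₁ ≤ κ₁b ∧ κ₂ ≤ κ₂b ∧ α ≤ 1 / 40 ∧ αN ≤ 1 / 100 ∧
        (1 + 24 * Real.sqrt d * (Real.exp (10 * (α + αN)) - 1) * (L : ℝ) ^ (j + 1)) ^ 2 + 48 * d * a * ((L : ℝ) ^ (j + 1)) ^ 2 ≤ Λ ∧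
        112 * (d : ℝ) * a * CP * ((L : ℝ) ^ (j + 1)) ^ 2 ≤ 1 / (2 * (Fintype.card n : ℝ))) :
    ∀ j : ℕ, ∀ V ∈ dom, ∀ UA UB : Site d → Fin d → (Matrix n n ℂ)ˣ, P j V UA UB →
      ∃ (u : Site d → (Matrix n n ℂ)ˣ) (Γ Ψ Ψ' : ℝ → Site d → Fin d → Matrix n n ℂ) (Xref : Site d → Fin d → Matrix n n ℂ) (α a : ℝ),
        0 ≤ α ∧ 0 ≤ a ∧
        EndpointChart 𝒞 L N (j + 1) V UA UB u Γ Ψ Ψ' Xref (frameFreeBlockLandauW L N (j + 1) (cavg L UB))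
          (fun Y => energyNormW L (j + 1) (cavg L UB) Y (periodBox (N * L ^ (j + 1))))
          (2 * (1 + 4 * Real.sqrt (16 * d + 1)) * νb) (2 * κ₁b + 912 * d * κ₂b) (νb + 23 * Real.sqrt 2 * Real.sqrt (16 * d + 1) * (1 + νb)) 0 a ∧
        (∀ t (x : Site d) (μ : Fin d), ‖Γ t x μ‖ ≤ α) ∧
        (1 + 24 * Real.sqrt d * (Real.exp α - 1) * (L : ℝ) ^ (j + 1)) ^ 2 + 48 * d * a * ((L : ℝ) ^ (j + 1)) ^ 2 ≤ Λ ∧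
        112 * (d : ℝ) * a * CP * ((L : ℝ) ^ (j + 1)) ^ 2 ≤ 1 / (2 * (Fintype.card n : ℝ)) := by
  intro j V hV UA UB hP
  obtain ⟨hW, u, X, Nn, α, αN, ν, κ₁, κ₂, a, h, hν, hκ₁, hκ₂, hα, hαN, hJ1, hJ2⟩ := hrep j V hV UA UB hP
  exact hchartPackage_of_decomposedRep_le hL hN hW h hν hκ₁ hκ₂ hα hαN hJ1 hJ2

end

end Summit.QuantumFields.BalabanUV.T4Continuum.NE3ChartLettersMono
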